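/-
Copyright (c) 2026. All rights reserved.
Released under Apache 2.0 license as described in the file LICENSE.
-/
import Literature.Probability.FitznerVanDerHofstad2017.NobleBoundsNMidSOne
import Literature.Probability.FitznerVanDerHofstad2017.NobleBoundsNMidF1
import HarnessLib

/-!
# Fitzner–van der Hofstad (2017), §6.1 (6.4): the generic letter package WITH the sausage-bond line

[FvdH17] = R. Fitzner, R. van der Hofstad, *Generalized approach to the non-backtracking lace expansion*,
arXiv:1506.07977v2 (EJP 22 (2017), paper 43).  Page numbers refer to the arXiv version.

`NobleBoundsNJointKit.nonempty_jPkg_of_joint` builds the letter package of ANY junction `k` from the joint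
witnesses with `useTZ := false`; the only constructor in the tree that uses the sausage-bond pseudo-line `xtz`
(the open bond `{t_k, z_k}` of an inner class `1`, read a second time on the LOWER coordinate `ω_k` and refunded
by the factor `p` of the `JPkg` letter bound — the `p⁻¹ · 2dD(z−t) · …` rows of App. B, [FvdH17] pp. 74–78) is
the terminal one, `NobleBoundsNEndC1.nonempty_jPkg_end_of_tz`.  This module is the junction-GENERIC form:

* `nonempty_jPkg_of_joint_tz` — data as in `nonempty_jPkg_of_joint` plus: `{t_k,z_k} ∈ ev xtz`; on the piece
  `t_k ≠ z_k` is a lattice bond (inner class `1`), `{u_k,v_k} ≠ {t_k,z_k}` when the pivotal-bond line is used,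
  and the upper witnesses put in the SAME LETTER as `xtz` avoid the bond `{t_k,z_k}` (at an inner-class-`1` level
  this is the normal form "the witness of `t ⇔ z` is `{t,z}`" plus the pairwise disjointness of the level's
  witnesses); the letter bound is against `p · tgt`.  The witnesses are the joint witnesses, `b_k` and `{t_k,z_k}`;
  the new compatibility pairs are `xtz / lo j` (`JFacts.bond`), `xtz / xb` (the hypothesis), `xtz / up j` (the
  hypothesis).
* the facts a middle / first provider feeds it at a junction `k = i` whose upper level has inner class `1`
  (`(τ i).2 = 1`): `t_k ≠ z_k` is a lattice bond (`JFacts.tz_facts_of_innerClass_one`); the pivotal bond is not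
  the sausage bond (`JFacts.bK_ne_tzB_midS` / `_midE`, from the vacancy clause `u_k ∉ {t_k, z_k, …}` of
  (4.59)–(4.61)); the open sausage bond is the witness of its own line — slot `1` on a `midS` level
  (`NobleBoundsNMidSOne.JFacts.tz_witness_midS`), slot `2` on a `midE` level (`JFacts.tz_witness_midE`) — so
  every OTHER upper witness avoids it (`JFacts.tz_notMem_midS` / `_midE`), whence the same-letter hypothesis for
  any grouping that keeps that slot out of the letter of `xtz` (`htzU_of_midS` / `htzU_of_midE`).

Conventions: `d`-generic; nothing is cited as a fact; additive (no existing declaration is changed).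
-/

noncomputable section

namespace Literature.Probability.FitznerVanDerHofstad2017

open Literature.Barriers.CriticalPhenomena Literature.Probability.Percolation
open Literature.Probability.LatticeModels Literature.Combinatorics.SimpleGraph _root_.SimpleGraph
open _root_.MeasureTheory
open Literature.Probability.FitznerVanDerHofstad2017.NobleBlocks
open Literature.Probability.FitznerVanDerHofstad2017.NobleBlocks.LenIdx
open scoped ENNReal

variable {d : ℕ}

section Joint

variable (p : unitInterval) {M : ℕ} {x : Site d} {b : Fin (M + 2) → Site d × Site d} {w t z : Fin (M + 2) → Site d}
  {a : Fin (M + 2) → Fin 3 ⊕ Unit} {c : Fin 3 ⊕ Unit} {τ : Fin (M + 1) → Bool × Fin 3}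

/-- **THE GENERIC PACKAGE OF A JUNCTION FROM THE JOINT WITNESSES, WITH THE SAUSAGE-BOND LINE.**  Data: the
junction `k`, a grouping `gl` of its local lines into letters whose cross-level letters join lower lines only with
ENTRY slots of the upper level, whether the pivotal-bond line is used (`uB`; then `{b_k} ∈ ev xb` and, on the
piece, `{b_k} ≠ {t_k,z_k}`), the sausage-bond line `xtz` in use (`{t_k,z_k} ∈ ev xtz`; on the piece `t_k ≠ z_k`
is a lattice bond, and every ACTIVE upper witness in the letter of `xtz` avoids `{t_k,z_k}`), finitary upgraded
events `ev` which, on the piece, contain the joint witness of every active slot, and the letter estimate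
`∏_l junF l ≤ p · tgt`.  Then a package with target `tgt` exists.
[cite: FitznerVanDerHofstad2017, §6.1 (6.4) and "Case b = 1" (arXiv:1506.07977v2 pp. 58–59); §4.4 (4.57)–(4.61), (4.65) (pp. 41, 43)] -/
theorem nonempty_jPkg_of_joint_tz (k : Fin (M + 2)) (gl : JIdx → JIdx) (uB : Bool)
    (ev : JIdx → Set (BondConfig (Site d))) (hfin : ∀ i, IsFinitary (ev i))
    (hB : uB = true → ({s((b k).1, (b k).2)} : Set (Sym2 (Site d))) ∈ ev .xb)
    (hT : ({s(t k, z k)} : Set (Sym2 (Site d))) ∈ ev .xtz)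
    (htz : ∀ ω K₀, JFacts M x b w t z a c τ ω K₀ → t k ≠ z k ∧ s(t k, z k) ∈ (zdGraph d).edgeSet)
    (hbtz : uB = true → ∀ ω K₀, JFacts M x b w t z a c τ ω K₀ → s((b k).1, (b k).2) ≠ s(t k, z k))
    (hgl : ∀ j j', (jctx M x b w t z a τ k).Act uB true (.lo j) → (jctx M x b w t z a τ k).Act uB true (.up j') →
      gl (.lo j) = gl (.up j') → IsEntry (pieceViews M x b w t z a τ k.succ).kd j')
    (htzU : ∀ ω K₀, JFacts M x b w t z a c τ ω K₀ → ∀ j, (jctx M x b w t z a τ k).Act uB true (.up j) →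
      gl (.up j) = gl .xtz → s(t k, z k) ∉ K₀ k.succ j)
    (hmem : ∀ ω K₀, JFacts M x b w t z a c τ ω K₀ →
      (∀ j, (jctx M x b w t z a τ k).Act uB true (.lo j) → K₀ k.castSucc j ∈ ev (.lo j)) ∧
        ∀ j, (jctx M x b w t z a τ k).Act uB true (.up j) → K₀ k.succ j ∈ ev (.up j))
    {tgt : ℝ≥0∞} (hrow : ∏ l, junF p M x b w t z a τ k gl uB true ev l ≤ ENNReal.ofReal p * tgt) :
    Nonempty (JPkg p (jctx M x b w t z a τ k) (JFacts M x b w t z a c τ) tgt) := by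
  refine ⟨{ gl := gl, A := ev, useB := uB, useTZ := true, fin := hfin, memB := hB
            memTZ := fun _ => hT, htz := fun _ ω K₀ hF => htz ω K₀ hF
            wit := fun ω K₀ hF => ?_, bound := ?_ }⟩
  · -- the re-witnessing: the joint witnesses themselves, `b_k`, `{t_k, z_k}`
    obtain ⟨h1, h2, h3, h4, hlu, h6⟩ := hF.compat k
    have hm := hmem ω K₀ hF
    have hne := (htz ω K₀ hF).1
    have hbL : ∀ j, s((b k).1, (b k).2) ∉ K₀ k.castSucc j := fun j hm' =>
      ((h1 j) hm').2 (bK_mem_off_castSucc (x := x) (w := w) (t := t) (z := z) (a := a) (τ := τ) k)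
    have hbU : ∀ j, s((b k).1, (b k).2) ∉ K₀ k.succ j := fun j hm' =>
      ((h2 j) hm').2 (bK_mem_off_succ (x := x) (w := w) (t := t) (z := z) (a := a) (τ := τ) k)
    have htzL : ∀ j, s(t k, z k) ∉ K₀ k.castSucc j := fun j => hF.bond k j hne
    refine ⟨Sum.elim (K₀ k.castSucc) (K₀ k.succ), ?_, ?_, ?_, ?_, ?_⟩
    · intro j hj
      exact ⟨h1 j, hm.1 j hj⟩
    · intro j hj
      exact ⟨h2 j, hm.2 j hj⟩
    · intro _ _
      exact subset_rfl
    · intro hl j hj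
      have hj5 : j ≠ 5 := by
        rcases hj.1 with h' | h'
        · rw [hl] at h'; exact absurd h' (by decide)
        · exact h'
      exact ⟨h4 j 5 hj5, h6 j hj.2⟩
    · intro i i' hi hi' hne' hrel
      cases i with
      | lo j =>
        cases i' with
        | lo j' => exact h3 j j' fun hjj => hne' (by rw [hjj])
        | up j' =>
          have hg : gl (.lo j) = gl (.up j') := by
            rcases hrel with h' | h'
            · exact absurd h' hlu
            · exact h'
          exact (hF.cross k j j' (hgl j j' hi hi' hg)).symm
        | xb => exact Set.disjoint_singleton_right.2 (hbL j)
        | xtz => exact Set.disjoint_singleton_right.2 (htzL j)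
      | up j =>
        cases i' with
        | lo j' =>
          have hg : gl (.lo j') = gl (.up j) := by
            rcases hrel with h' | h'
            · exact absurd h'.symm hlu
            · exact h'.symm
          exact hF.cross k j' j (hgl j' j hi' hi hg)
        | up j' => exact h4 j j' fun hjj => hne' (by rw [hjj])
        | xb => exact Set.disjoint_singleton_right.2 (hbU j)
        | xtz =>
          have hg : gl (.up j) = gl .xtz := by
            rcases hrel with h' | h'
            · exact absurd h'.symm hlu
            · exact h'
          exact Set.disjoint_singleton_right.2 (htzU ω K₀ hF j hi hg)
      | xb =>
        cases i' with
        | lo j' => exact Set.disjoint_singleton_left.2 (hbL j')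
        | up j' => exact Set.disjoint_singleton_left.2 (hbU j')
        | xb => exact absurd rfl hne'
        | xtz => exact Set.disjoint_singleton.2 (hbtz hi ω K₀ hF)
      | xtz =>
        cases i' with
        | lo j' => exact Set.disjoint_singleton_left.2 (htzL j')
        | up j' =>
          have hg : gl (.up j') = gl .xtz := by
            rcases hrel with h' | h'
            · exact absurd h' hlu
            · exact h'.symm
          exact Set.disjoint_singleton_left.2 (htzU ω K₀ hF j' hi' hg)
        | xb => exact Set.disjoint_singleton.2 (hbtz hi' ω K₀ hF).symm
        | xtz => exact absurd rfl hne'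
  · -- the letter bound
    show ∏ l, junF p M x b w t z a τ k gl uB true ev l ≤ _
    rw [Bool.toNat_true, pow_one]
    exact hrow

/-- **Inner class `1` supplies the sausage-bond facts**: at a junction `k = i` with `(τ i).2 = 1`, on the piece
`t_k ≠ z_k` and `{t_k, z_k}` is a lattice bond. [cite: FitznerVanDerHofstad2017, §5.1 "d_ω(t,z) = 1" rows (arXiv:1506.07977v2 p. 47); App. B (p. 76)] -/
theorem JFacts.tz_facts_of_innerClass_one {ω : Fin (M + 3) → BondConfig (Site d)}
    {K₀ : Fin (M + 3) → Fin 6 → Set (Sym2 (Site d))} (h : JFacts M x b w t z a c τ ω K₀) (i : Fin (M + 1))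
    (h1 : (τ i).2 = 1) :
    t i.castSucc ≠ z i.castSucc ∧ s(t i.castSucc, z i.castSucc) ∈ (zdGraph d).edgeSet :=
  ⟨(h.innerClass_one i h1).1, h.lattice _ (h.innerClass_one i h1).2.1⟩

end Joint

/-! ### B. The sausage-bond facts of an inner-class-`1` level (middle or first junction `k = i`) -/

section TZFacts

variable {M : ℕ} {x : Site d} {b : Fin (M + 2) → Site d × Site d} {w t z : Fin (M + 2) → Site d}
  {a : Fin (M + 2) → Fin 3 ⊕ Unit} {c : Fin 3 ⊕ Unit} {τ : Fin (M + 1) → Bool × Fin 3}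
  {ω : Fin (M + 3) → BondConfig (Site d)} {K₀ : Fin (M + 3) → Fin 6 → Set (Sym2 (Site d))}

/-- On a `midS` level `k + 1` the pivotal bond `b_k` is not the sausage bond `{t_k, z_k}` (`u_k ∉ {t_k, z_k}`).
[cite: FitznerVanDerHofstad2017, (4.61) "b̲_{i-1} ∉ {t_i, z_i, …}" (arXiv:1506.07977v2 p. 41)] -/
theorem JFacts.bK_ne_tzB_midS (h : JFacts M x b w t z a c τ ω K₀) (i : Fin (M + 1)) (hσ : (τ i).1 = false)
    {a' : Fin 3} (ha' : a i.succ = Sum.inl a') :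
    s((b i.castSucc).1, (b i.castSucc).2) ≠ s(t i.castSucc, z i.castSucc) := by
  have hv := h.vac_midS i hσ ha'
  simp only [Set.mem_insert_iff, Set.mem_singleton_iff, not_or] at hv
  exact (sym2_ne_of_ne (Ne.symm hv.1) (Ne.symm hv.2.2.1)).symm

/-- On a `midE` level `k + 1` the pivotal bond `b_k` is not the sausage bond `{t_k, z_k}` (`u_k ∉ {t_k, z_k}`).
[cite: FitznerVanDerHofstad2017, (4.59)–(4.60) "b̲_{i-1} ∉ {t_i, z_i, …}" (arXiv:1506.07977v2 p. 41)] -/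
theorem JFacts.bK_ne_tzB_midE (h : JFacts M x b w t z a c τ ω K₀) (i : Fin (M + 1)) (hσ : (τ i).1 = true)
    {a' : Fin 3} (ha' : a i.succ = Sum.inl a') :
    s((b i.castSucc).1, (b i.castSucc).2) ≠ s(t i.castSucc, z i.castSucc) := by
  have hv := h.vac_midE i hσ ha'
  simp only [Set.mem_insert_iff, Set.mem_singleton_iff, not_or] at hv
  exact (sym2_ne_of_ne (Ne.symm hv.1) (Ne.symm hv.2.2.1)).symm

/-- **Inner class `1`, `midS`: every upper witness other than the sausage line's (slot `1`) avoids `{t_k, z_k}`.**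
[cite: FitznerVanDerHofstad2017, §6.1 "Case b = 1" (arXiv:1506.07977v2 p. 59); (4.61) "∘" (p. 41)] -/
theorem JFacts.tz_notMem_midS (h : JFacts M x b w t z a c τ ω K₀) (i : Fin (M + 1)) (hσ : (τ i).1 = false)
    {a' : Fin 3} (ha' : a i.succ = Sum.inl a') (hc1 : (τ i).2 = 1) {j : Fin 6} (hj : j ≠ 1) :
    s(t i.castSucc, z i.castSucc) ∉ K₀ i.castSucc.succ j := by
  have h1 := h.innerClass_one i hc1
  have hd := h.disj i.castSucc.succ 1 j hj.symm
  rw [h.tz_witness_midS i hσ ha' h1.1 h1.2.1] at hd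
  exact Set.disjoint_singleton_left.1 hd

/-- **The open sausage bond is its own witness** on a `midE` level `k + 1` (slot `2`).
[cite: FitznerVanDerHofstad2017, §6.1 proof of Lemma 5.2, Case b = 1, "we include the information that … z, t are neighbors" (arXiv:1506.07977v2 p. 59); §4.4 after (4.65) (p. 43)] -/
theorem JFacts.tz_witness_midE (h : JFacts M x b w t z a c τ ω K₀) (i : Fin (M + 1)) (hσ : (τ i).1 = true)
    {a' : Fin 3} (ha' : a i.succ = Sum.inl a') (htz : t i.castSucc ≠ z i.castSucc)
    (hb : s(t i.castSucc, z i.castSucc) ∈ ω i.castSucc.succ) :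
    K₀ i.castSucc.succ 2 = {s(t i.castSucc, z i.castSucc)} := by
  have h9 := h.conds.tzNF i.castSucc.succ
  rw [pieceViews_midE M x b w t z a τ i hσ ha'] at h9
  exact h9 (fun h => by cases h) htz hb

/-- **Inner class `1`, `midE`: every upper witness other than the sausage line's (slot `2`) avoids `{t_k, z_k}`.**
[cite: FitznerVanDerHofstad2017, §6.1 "Case b = 1" (arXiv:1506.07977v2 p. 59); (4.59)–(4.60) "∘" (p. 41)] -/
theorem JFacts.tz_notMem_midE (h : JFacts M x b w t z a c τ ω K₀) (i : Fin (M + 1)) (hσ : (τ i).1 = true)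
    {a' : Fin 3} (ha' : a i.succ = Sum.inl a') (hc1 : (τ i).2 = 1) {j : Fin 6} (hj : j ≠ 2) :
    s(t i.castSucc, z i.castSucc) ∉ K₀ i.castSucc.succ j := by
  have h1 := h.innerClass_one i hc1
  have hd := h.disj i.castSucc.succ 2 j hj.symm
  rw [h.tz_witness_midE i hσ ha' h1.1 h1.2.1] at hd
  exact Set.disjoint_singleton_left.1 hd

variable (M x b w t z a c τ) in
/-- The same-letter hypothesis `htzU` of `nonempty_jPkg_of_joint_tz` at a junction whose upper level is `midS`
of inner class `1`, for any grouping keeping slot `1` out of the letter of `xtz`.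
[cite: FitznerVanDerHofstad2017, §6.1 "Case b = 1" (arXiv:1506.07977v2 p. 59); §4.4 after (4.65) (p. 43)] -/
theorem htzU_of_midS (i : Fin (M + 1)) (hσ : (τ i).1 = false) {a' : Fin 3} (ha' : a i.succ = Sum.inl a')
    (hc1 : (τ i).2 = 1) (gl : JIdx → JIdx) (uB : Bool) (hg : ∀ j, gl (.up j) = gl .xtz → j ≠ 1) :
    ∀ ω K₀, JFacts M x b w t z a c τ ω K₀ → ∀ j, (jctx M x b w t z a τ i.castSucc).Act uB true (.up j) →
      gl (.up j) = gl .xtz → s(t i.castSucc, z i.castSucc) ∉ K₀ i.castSucc.succ j :=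
  fun _ _ hF j _ hgj => hF.tz_notMem_midS i hσ ha' hc1 (hg j hgj)

variable (M x b w t z a c τ) in
/-- The same-letter hypothesis `htzU` of `nonempty_jPkg_of_joint_tz` at a junction whose upper level is `midE`
of inner class `1`, for any grouping keeping slot `2` out of the letter of `xtz`.
[cite: FitznerVanDerHofstad2017, §6.1 "Case b = 1" (arXiv:1506.07977v2 p. 59); §4.4 after (4.65) (p. 43)] -/
theorem htzU_of_midE (i : Fin (M + 1)) (hσ : (τ i).1 = true) {a' : Fin 3} (ha' : a i.succ = Sum.inl a')
    (hc1 : (τ i).2 = 1) (gl : JIdx → JIdx) (uB : Bool) (hg : ∀ j, gl (.up j) = gl .xtz → j ≠ 2) :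
    ∀ ω K₀, JFacts M x b w t z a c τ ω K₀ → ∀ j, (jctx M x b w t z a τ i.castSucc).Act uB true (.up j) →
      gl (.up j) = gl .xtz → s(t i.castSucc, z i.castSucc) ∉ K₀ i.castSucc.succ j :=
  fun _ _ hF j _ hgj => hF.tz_notMem_midE i hσ ha' hc1 (hg j hgj)

end TZFacts

end Literature.Probability.FitznerVanDerHofstad2017

end
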